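import Summits.CriticalPhenomena.SAWScalingLimit.Theorems.SAWRenewalTightnessSubseqIdentificationSteeringVertical
import Summits.CriticalPhenomena.SAWScalingLimit.Theorems.SAWRenewalTightnessSubseqIdentificationSteeringArc
import Summits.CriticalPhenomena.SAWScalingLimit.Theorems.SAWRenewalTightnessSubseqIdentificationCompensatorTube
import Summits.CriticalPhenomena.SAWScalingLimit.Theorems.SAWRenewalTightnessSubseqIdentificationEssUnboundedOfTube
import HarnessLib

/-!
# L3 of line `boundary-area-law`: essential unboundedness of the LSW compensator on the avoidance event

Crux `SubseqIdentification` (stmt-CriticalPhenomena-0783), line `boundary-area-law`, registered stub L3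
`stub_compensatorEssUnbounded` (stated by lead c4, r-c4-7/8; PROVED here by lead c5's reshape r-c5-1):
for `0 < κ < 8/3`, every nonempty `A ∈ 𝒬*` and every `ε > 0`,
`P[γ ∩ A = ∅ ∧ exp(−λ_κ ∫₀^∞ m(A_t − W_t) dt) < ε] > 0` for the chordal SLE_κ trace `γ`.
It is the GLUE over the four landed stubs of the support route by semicircle steering:
L3a-V `stub_steeringVertical` (p157732: zero driver aimed at the lowest axis point),
L3a-A `stub_steeringArc` (p158795: Möbius image of the zero-driver chain aimed along the semicircle
through a point of `A ∩ ℍ` off the axis, `LoewnerMoebiusImageChain`), L3b `stub_compensatorTube`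
(p157904: Kemppainen–Smirnov stability + the pointwise mass bound), L3c
`stub_compensatorEssUnbounded_of_tube` (p160197: tube positivity + simple Markov property + point
cocycle + [LSW] Thm. 6.5), plus the case split "some point of `A ∩ ℍ` off the imaginary axis, or the
lowest axis point" (compactness, `0 ∉ A`). With L3 the restriction rigidity of SLE_κ below `8/3`
(RS5 `stub_sleRestrictionRigidityBelow`) is unconditional (landed glue p154031 over L1 p152723,
L2′ p153880, L3). No named fact is used.

References: G. F. Lawler, O. Schramm, W. Werner, *Conformal restriction: the chordal case* (2003),
§5 and Thm. 6.5; G. F. Lawler, *Conformally Invariant Processes in the Plane* (2005), §4.1, §4.6.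
-/

noncomputable section

open MeasureTheory Filter Topology Set Metric
open scoped NNReal ENNReal
open Literature.Probability.RandomPlanarGeometry
open Literature.Probability.Process (preWienerMeasure)
open UpperHalfPlane (upperHalfPlaneSet)

namespace Summit.CriticalPhenomena.SAWScalingLimit.Theorems.SubseqIdentification.BoundaryAreaLaw

/-- A nonempty `*`-hull has a point in the open upper half-plane (`A = closure (A ∩ ℍ)`). -/
theorem exists_mem_im_pos_c5 {A : Set ℂ} (hA : IsStarHull A) (hne : A.Nonempty) :
    ∃ z ∈ A, 0 < z.im := by
  by_contra h
  push Not at h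
  have hempty : A ∩ upperHalfPlaneSet = ∅ := by
    ext z
    simp only [mem_inter_iff, mem_empty_iff_false, iff_false, not_and]
    intro hz hzH
    exact absurd hzH (not_lt.2 (h z hz))
  have := hA.isBoundedHull.closure_inter_eq
  rw [hempty, closure_empty] at this
  exact hne.ne_empty this.symm

/-- **The lowest point of a `*`-hull on the imaginary axis** (compactness; `0 ∉ A`): if `i y₁ ∈ A` for some `y₁ > 0` then there is
`y₀ ∈ (0, y₁]` with `i y₀ ∈ A` and `i y ∉ A` for `0 < y < y₀`. -/
theorem exists_lowest_axis_point_c5 {A : Set ℂ} (hA : IsStarHull A) {y₁ : ℝ} (hy₁ : 0 < y₁)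
    (hmem : Complex.I * y₁ ∈ A) :
    ∃ y₀ : ℝ, 0 < y₀ ∧ Complex.I * y₀ ∈ A ∧ ∀ y : ℝ, 0 < y → y < y₀ → Complex.I * y ∉ A := by
  set T : Set ℝ := {y ∈ Icc 0 y₁ | Complex.I * y ∈ A} with hT
  have hcont : Continuous fun y : ℝ => Complex.I * (y : ℂ) := continuous_const.mul Complex.continuous_ofReal
  have hTclosed : IsClosed T := (isClosed_Icc.inter (hA.isBoundedHull.isClosed.preimage hcont))
  have hTcomp : IsCompact T := isCompact_Icc.of_isClosed_subset hTclosed (fun y hy => hy.1)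
  have hTne : T.Nonempty := ⟨y₁, ⟨le_of_lt hy₁, le_rfl⟩, hmem⟩
  obtain ⟨y₀, hy₀T, hy₀min⟩ := hTcomp.exists_isMinOn hTne continuous_id.continuousOn
  refine ⟨y₀, ?_, hy₀T.2, fun y hy hyy h => ?_⟩
  · rcases hy₀T.1.1.eq_or_lt with h0 | h0
    · exfalso
      have : (0 : ℂ) ∈ A := by simpa [← h0] using hy₀T.2
      exact hA.zero_notMem this
    · exact h0
  · have hyT : y ∈ T := ⟨⟨hy.le, (hyy.le.trans hy₀T.1.2)⟩, h⟩
    have := hy₀min hyT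
    simp only [id_eq] at this
    exact absurd hyy (not_lt.2 this)

/-- **L3a — STEERING DATA FOR EVERY NONEMPTY `*`-HULL** (glue of the two cases, sorry-free): a point of `A ∩ ℍ` exists; if one lies off
the imaginary axis use the arc, otherwise the lowest axis point and the vertical ray (zero driver). -/
theorem compensatorSteering_of_cases
    (hV : ∀ (A : Set ℂ), IsStarHull A → ∀ (y₀ : ℝ), 0 < y₀ → Complex.I * y₀ ∈ A →
      (∀ y : ℝ, 0 < y → y < y₀ → Complex.I * y ∉ A) → ∀ (q : ℝ),
      ∃ S : ℝ≥0, (∀ z ∈ A, (S : WithTop ℝ≥0) < Loewner.swallowingTime (fun _ : ℝ≥0 => (0 : ℝ)) z) ∧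
        ENNReal.ofReal q ≤ ∫⁻ s in Set.Ioc (0 : ℝ) S,
          ENNReal.ofReal (((Loewner.map (fun _ : ℝ≥0 => (0 : ℝ)) s.toNNReal (Complex.I * y₀)).im /
            Complex.normSq (Loewner.map (fun _ : ℝ≥0 => (0 : ℝ)) s.toNNReal (Complex.I * y₀))) ^ 2 / 2))
    (hArc : ∀ (A : Set ℂ), IsStarHull A → ∀ (z₀ : ℂ), z₀ ∈ A → 0 < z₀.im → z₀.re ≠ 0 → ∀ (q : ℝ),
      ∃ (U : ℝ≥0 → ℝ) (S : ℝ≥0) (a : ℂ), Continuous U ∧ U 0 = 0 ∧ a ∈ A ∧ 0 < a.im ∧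
        (∀ z ∈ A, (S : WithTop ℝ≥0) < Loewner.swallowingTime U z) ∧
        ENNReal.ofReal q ≤ ∫⁻ s in Set.Ioc (0 : ℝ) S,
          ENNReal.ofReal (((Loewner.map U s.toNNReal a - U s.toNNReal).im /
            Complex.normSq (Loewner.map U s.toNNReal a - U s.toNNReal)) ^ 2 / 2)) :
    ∀ (A : Set ℂ), IsStarHull A → A.Nonempty → ∀ (q : ℝ),
      ∃ (U : ℝ≥0 → ℝ) (S : ℝ≥0) (a : ℂ), Continuous U ∧ U 0 = 0 ∧ a ∈ A ∧ 0 < a.im ∧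
        (∀ z ∈ A, (S : WithTop ℝ≥0) < Loewner.swallowingTime U z) ∧
        ENNReal.ofReal q ≤ ∫⁻ s in Set.Ioc (0 : ℝ) S,
          ENNReal.ofReal (((Loewner.map U s.toNNReal a - U s.toNNReal).im /
            Complex.normSq (Loewner.map U s.toNNReal a - U s.toNNReal)) ^ 2 / 2) := by
  intro A hA hne q
  obtain ⟨z, hzA, hzi⟩ := exists_mem_im_pos_c5 hA hne
  by_cases hre : z.re ≠ 0
  · exact hArc A hA z hzA hzi hre q
  · push Not at hre
    have hz : z = Complex.I * (z.im : ℂ) := by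
      apply Complex.ext <;> simp [hre]
    obtain ⟨y₀, hy₀, hy₀A, hlow⟩ := exists_lowest_axis_point_c5 hA hzi (hz ▸ hzA)
    obtain ⟨S, halive, hint⟩ := hV A hA y₀ hy₀ hy₀A hlow q
    refine ⟨fun _ => 0, S, Complex.I * y₀, continuous_const, rfl, hy₀A, by simp [hy₀], halive, ?_⟩
    simpa using hint

/-- **TUBE STATEMENT FOR EVERY NONEMPTY `*`-HULL** from L3a (both cases) and L3b (sorry-free glue). -/
theorem compensatorTubeAll_of_parts
    (hS : ∀ (A : Set ℂ), IsStarHull A → A.Nonempty → ∀ (q : ℝ),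
      ∃ (U : ℝ≥0 → ℝ) (S : ℝ≥0) (a : ℂ), Continuous U ∧ U 0 = 0 ∧ a ∈ A ∧ 0 < a.im ∧
        (∀ z ∈ A, (S : WithTop ℝ≥0) < Loewner.swallowingTime U z) ∧
        ENNReal.ofReal q ≤ ∫⁻ s in Set.Ioc (0 : ℝ) S,
          ENNReal.ofReal (((Loewner.map U s.toNNReal a - U s.toNNReal).im /
            Complex.normSq (Loewner.map U s.toNNReal a - U s.toNNReal)) ^ 2 / 2))
    (hT : ∀ (A : Set ℂ), IsStarHull A → ∀ (U : ℝ≥0 → ℝ) (S : ℝ≥0) (a : ℂ) (q : ℝ),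
      Continuous U → a ∈ A → 0 < a.im →
      (∀ z ∈ A, (S : WithTop ℝ≥0) < Loewner.swallowingTime U z) →
      ENNReal.ofReal (4 * q) ≤ ∫⁻ s in Set.Ioc (0 : ℝ) S,
          ENNReal.ofReal (((Loewner.map U s.toNNReal a - U s.toNNReal).im /
            Complex.normSq (Loewner.map U s.toNNReal a - U s.toNNReal)) ^ 2 / 2) →
      ∃ η : ℝ, 0 < η ∧ ∀ (W : ℝ≥0 → ℝ), Continuous W → (∀ s : ℝ≥0, s ≤ S → |W s - U s| ≤ η) →
        (∀ z ∈ A, (S : WithTop ℝ≥0) < Loewner.swallowingTime W z) ∧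
        ENNReal.ofReal q ≤ ∫⁻ s in Set.Ioc (0 : ℝ) S,
          ENNReal.ofReal (starBubbleMass (Loewner.slidHull W A s.toNNReal))) :
    ∀ (A : Set ℂ), IsStarHull A → A.Nonempty → ∀ q : ℝ,
      ∃ (U : ℝ≥0 → ℝ) (S : ℝ≥0) (η : ℝ), Continuous U ∧ U 0 = 0 ∧ 0 < η ∧
        ∀ (W : ℝ≥0 → ℝ), Continuous W → (∀ s : ℝ≥0, s ≤ S → |W s - U s| ≤ η) →
          (∀ z ∈ A, (S : WithTop ℝ≥0) < Loewner.swallowingTime W z) ∧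
          ENNReal.ofReal q ≤ ∫⁻ s in Set.Ioc (0 : ℝ) S,
            ENNReal.ofReal (starBubbleMass (Loewner.slidHull W A s.toNNReal)) := by
  intro A hA hne q
  obtain ⟨U, S, a, hU, hU0, haA, hai, halive, hint⟩ := hS A hA hne (4 * q)
  obtain ⟨η, hη, hgood⟩ := hT A hA U S a q hU haA hai halive hint
  exact ⟨U, S, η, hU, hU0, hη, hgood⟩

/-- **L3 — ESSENTIAL UNBOUNDEDNESS OF THE COMPENSATOR ON THE AVOIDANCE EVENT (registered stub
`stub_compensatorEssUnbounded` of line `boundary-area-law`, PROVED).** For `0 < κ < 8/3`, a nonempty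
`A ∈ 𝒬*` and every `ε > 0`: `P[γ ∩ A = ∅, exp(−λ_κ L^A) < ε] > 0`. Glue over L3a-V, L3a-A, L3b, L3c.
[cite: LawlerSchrammWerner2003Restriction, §5 and Thm. 6.5] -/
theorem stub_compensatorEssUnbounded :
    ∀ (κ : ℝ≥0), 0 < κ → κ < 8 / 3 → ∀ (A : Set ℂ), IsStarHull A → A.Nonempty →
      ∀ (ε : ℝ), 0 < ε →
        0 < preWienerMeasure {ω | Disjoint (range (sleTrace κ ω)) A ∧
            poissonAvoidance (sleBubbleIntensity κ *
              ∫⁻ t, ENNReal.ofReal (starBubbleMass (Loewner.slidHull (sleDriving κ ω) A t)) ∂timeMeasure) <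
              ENNReal.ofReal ε} :=
  stub_compensatorEssUnbounded_of_tube
    (compensatorTubeAll_of_parts (compensatorSteering_of_cases stub_steeringVertical stub_steeringArc)
      stub_compensatorTube)

end Summit.CriticalPhenomena.SAWScalingLimit.Theorems.SubseqIdentification.BoundaryAreaLaw

end
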